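import Summits.BirchSwinnertonDyer.BirchSwinnertonDyer.Theorems.ByReductionTypeAtTwoMultTransportTwistedDescentTateLine
import Literature.NumberTheory.EllipticCurves.ZpExtensionGaloisTwistWeilDual
import Literature.NumberTheory.GaloisRepresentations.ContinuousRepHomDual
import Literature.NumberTheory.GaloisRepresentations.ContinuousCohomologyConnecting
import Literature.NumberTheory.GaloisRepresentations.CorNaturality
import Literature.NumberTheory.GaloisRepresentations.FiniteCoefficients
import HarnessLib

/-!
# T-42 in the kernel, LXIV: the dual Kummer condition at a finite place `v ∣ p` for ANY LINE `C ⊆ E[p^∞]` with the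
# three line properties (reduction-type-generic form of file XXIX `…TwistedDescentDualTwo`)

Cell `bsd-2adic` (run/shared/lean/pub/bsd-2adic/), seat `bsd-2adic-t42` (BRIEF-T42), GEN 29 (memo
`t42/DESIGN-T42-ADDENDUM-33.md`, «F3a road»). HONEST FRAMING: research route; THEOREMS ONLY (no `def`, no named
fact, no instance); nothing booked; nothing re-keyed; BSD is not proved by any of this. PARTITION: X5@2 GV-transport
rows whose REFERENCE curve is GOOD ORDINARY at `2` (K4ᵐ B1·O1; the binder `hF3a` of p744459) × p = 2 —
types-the-object-of; bears_on K4 items 19922 / 19923 (`--supports stmt-BirchSwinnertonDyer-19923`).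

## What

File XXIX proves the dual Kummer condition `δ2` at a place `v ∣ p` of MULTIPLICATIVE reduction: for the twisted
modules `M_u = E[p^J](χ_u)`, `M_{u'} = E[p^J](χ_{u'})` (`u u' ≡ 1 mod p^J`) and the twisted Weil duality
`w : M_{u'} ⥲ M_u^D`, «if `y' ∈ H¹(K_v, M_{u'})` pairs to zero with every class of `H¹(K_v, M_u)` killed by
`twistedTorsionToLocalH1^{(u)}`, then `twistedTorsionToLocalH1^{(u')} y' = 0`». Its proof uses the multiplicative
reduction only through the Tate LINE of file XXVII: a `LocalDatum` `N` at `v` with `N.plus` `p`-divisible,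
`#(N.plus ∩ E[p^∞][p]) = p`, and every continuous `N.plus`-valued crossed homomorphism of `G_K = (ker κ)_v` a Kummer
coboundary. This file re-proves the statement for ANY such line, any number field `K`, any `p`:

* `twistedTorsionToLocalH1_eq_zero_of_dual_finitePlace_of_line` — XXIX's four-step proof VERBATIM (isotropy and
  maximal isotropy of `C_J = C ∩ E[p^J]`, file XXVIII; local Tate duality for `C(χ_u)`; the short exact sequence
  `0 → C(χ_{u'}) → M_{u'} → Hom(C(χ_u), μ) → 0`; classes from the line die under `twistedTorsionToLocalH1`).

Consumer (same GEN): `…TwistedDescentOrdT2Final` — `δ2` at a GOOD ORDINARY `2` from the reduction-datum line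
package of `…TwistedDescentOrdLinePackage`.

References: [GreenbergLNM1716] §2 pp. 74–76, §4 pp. 123–124; [MilneADT2006] I Cor. 2.3, I §6;
[SerreGaloisCohomology1997] II §5.2; [SilvermanAEC2009] III.8.1.
-/

set_option autoImplicit false
set_option linter.dupNamespace false

noncomputable section

open scoped Classical AddSubgroup ContRepresentation

namespace Summit.BirchSwinnertonDyer.BirchSwinnertonDyer.Theorems.MultTransportTwistedDescent

open NumberField IsDedekindDomain Field WeierstrassCurve CategoryTheory Function
  Literature.NumberTheory.GaloisRepresentations Literature.NumberTheory.EllipticCurves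
  Literature.NumberTheory.EllipticCurves.GreenbergSelmer IsDedekindDomain.HeightOneSpectrum
  Summit.BirchSwinnertonDyer.Rank1Residual.X2
open Literature.NumberTheory.GaloisRepresentations.DiscreteGaloisModule (localTatePairingZMod localTatePairing
  TateDual tateDual mu MuCarrier)

/-! ## The dual Kummer condition at `v ∣ p` for a line with the three properties, any number field -/

section NumberField

variable {K : Type} [Field K] [NumberField K] (W : WeierstrassCurve K) [W.IsElliptic] (p : ℕ)
  [hp : Fact p.Prime] (κ : ZpExtension K p) (J : ℕ) {u u' : ℤ} (hu : (p : ℤ) ∣ u - 1) (hu' : (p : ℤ) ∣ u' - 1)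
  (huu' : ((p : ℤ) ^ J) ∣ u * u' - 1)
  (e : W.geomTorsion ((p ^ J : ℕ) : ℤ) → W.geomTorsion ((p ^ J : ℕ) : ℤ) → AlgebraicClosure K)
  (hμ : ∀ S T, e S T ^ (p ^ J) = 1)
  (hadd₁ : ∀ S₁ S₂ T, e (S₁ + S₂) T = e S₁ T * e S₂ T)
  (hadd₂ : ∀ S T₁ T₂, e S (T₁ + T₂) = e S T₁ * e S T₂)
  (hgal : ∀ (σ : absoluteGaloisGroup K) (S T : W.geomTorsion ((p ^ J : ℕ) : ℤ)),
    σ • e S T = e (σ • S) (σ • T))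
  (halt : ∀ T, e T T = 1) (hnondeg : ∀ T, (∀ S, e S T = 1) → T = 0)
  [Finite (W.geomTorsion ((p ^ J : ℕ) : ℤ))]

include halt hnondeg in
/-- **The dual Kummer condition at a finite place `v ∣ p` for ANY line `C = N.plus ⊆ E[p^∞]`** which is `p`-divisible
with `#C[p] = p` and whose continuous `C`-valued crossed homomorphisms of `G_K = (ker κ)_v` are Kummer coboundaries
(see the module docstring for the statement and the four-step proof; file XXIX is the case of the Tate line).
[cite: GreenbergLNM1716, §2 pp. 74–76 and §4 pp. 123–124] [cite: MilneADT2006, Ch. I, Cor. 2.3] -/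
theorem twistedTorsionToLocalH1_eq_zero_of_dual_finitePlace_of_line
    (v : HeightOneSpectrum (𝓞 K)) (N : LocalDatum K (W.geomPrimaryTorsion p) v)
    (hdiv : ∀ c ∈ N.plus, ∃ c' ∈ N.plus, p • c' = c)
    (hcard : Nat.card ↥(N.plus ⊓ (↥(W.geomPrimaryTorsion p))[(p : ℤ)]) = p)
    (hKum : ∀ (f : localSubgroup κ.kerSubgroup (v.adicCompletion K) → W.geomPrimaryTorsion p),
      (∀ τ, f τ ∈ N.plus) → Continuous f →
      (∀ τ₁ τ₂, f (τ₁ * τ₂) = f τ₁ + resGal (K := K) (v.adicCompletion K)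
        (τ₁ : absoluteGaloisGroup (v.adicCompletion K)) • f τ₂) →
      ∃ Q : localPoints W (v.adicCompletion K),
        ∀ τ : localSubgroup κ.kerSubgroup (v.adicCompletion K),
          pointsMap W (v.adicCompletion K) (f τ : W.geomPoints) =
            (τ : absoluteGaloisGroup (v.adicCompletion K)) • Q - Q)
    (ιv : galoisCohomology ((mu K (p ^ J)).toLocal (Sum.inr v)) 2 →+ ZMod (p ^ J))
    (hι : Injective ιv)
    (y' : galoisCohomology ((W.twistedTorsionGaloisModule p κ J u' hu').restrictField (v.adicCompletion K)) 1)
    (H : ∀ a : galoisCohomology ((W.twistedTorsionGaloisModule p κ J u hu).restrictField (v.adicCompletion K)) 1,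
      W.twistedTorsionToLocalH1 p κ J u hu (v.adicCompletion K) a = 0 →
      localTatePairingZMod (W.twistedTorsionGaloisModule p κ J u hu) (p ^ J) (Sum.inr v) ιv a
        (galoisCohomology.map
          ((W.twistedWeilDual p κ J hu hu' huu' e hμ hadd₁ hadd₂ hgal).restrictField (v.adicCompletion K)) 1 y') =
        0) :
    W.twistedTorsionToLocalH1 p κ J u' hu' (v.adicCompletion K) y' = 0 := by
  haveI : NeZero (p ^ J) := ⟨pow_ne_zero _ hp.out.ne_zero⟩
  haveI : CharZero K := charZero_of_injective_algebraMap (algebraMap ℚ K).injective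
  haveI : CharZero (v.adicCompletion K) := charZero_adicCompletion v
  haveI : CompactSpace (absoluteGaloisGroup (v.adicCompletion K)) :=
    absoluteGaloisGroup_compactSpace (v.adicCompletion K)
  -- the level-`J` part of the line
  let C : Submodule ℤ (W.geomTorsion ((p ^ J : ℕ) : ℤ)) :=
    (N.plus.comap (AddSubgroup.inclusion
      (Literature.Barriers.BirchSwinnertonDyer.geomTorsion_pow_le_geomPrimaryTorsion W p J))).toIntSubmodule
  have hC : ∀ T, T ∈ C ↔ AddSubgroup.inclusion
      (Literature.Barriers.BirchSwinnertonDyer.geomTorsion_pow_le_geomPrimaryTorsion W p J) T ∈ N.plus :=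
    fun T ↦ Iff.rfl
  -- the two twisted local modules (over `Γ_{K_v}`) and the line inside them
  have hCu : ∀ g, C ≤ C.comap
      (((W.twistedTorsionGaloisModule p κ J u hu).restrict (absGaloisRestrict K (v.adicCompletion K))) g) :=
    line_le_comap_twistedTorsionGaloisModule W p κ J u hu N C hC
  have hCu' : ∀ g, C ≤ C.comap
      (((W.twistedTorsionGaloisModule p κ J u' hu').restrict (absGaloisRestrict K (v.adicCompletion K))) g) :=
    line_le_comap_twistedTorsionGaloisModule W p κ J u' hu' N C hC
  let i := subtypeHom
    ((W.twistedTorsionGaloisModule p κ J u hu).restrict (absGaloisRestrict K (v.adicCompletion K))) C hCu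
  let i' := subtypeHom
    ((W.twistedTorsionGaloisModule p κ J u' hu').restrict (absGaloisRestrict K (v.adicCompletion K))) C hCu'
  -- duals over the local field `F = K_v`
  let eD := (tateDualLocalIso v (W.twistedTorsionGaloisModule p κ J u hu) (p ^ J)).hom
  let wF : ContinuousRep.toTopRep
      ((W.twistedTorsionGaloisModule p κ J u' hu').restrict (absGaloisRestrict K (v.adicCompletion K))) ⟶
      (((W.twistedTorsionGaloisModule p κ J u hu).tateDual (p ^ J)).restrict
        (absGaloisRestrict K (v.adicCompletion K))).toTopRep :=
    TopRep.ofHom ⟨((W.twistedWeilDual p κ J hu hu' huu' e hμ hadd₁ hadd₂ hgal).restrictField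
      (v.adicCompletion K)).toContinuousLinearMap,
      ((W.twistedWeilDual p κ J hu hu' huu' e hμ hadd₁ hadd₂ hgal).restrictField
        (v.adicCompletion K)).isIntertwining'⟩
  let iD : (((W.twistedTorsionGaloisModule p κ J u hu).restrict
        (absGaloisRestrict K (v.adicCompletion K))).homRep (mu (v.adicCompletion K) (p ^ J))).toTopRep ⟶
      ((((W.twistedTorsionGaloisModule p κ J u hu).restrict
        (absGaloisRestrict K (v.adicCompletion K))).subrepresentation C hCu).homRep
          (mu (v.adicCompletion K) (p ^ J))).toTopRep :=
    ContinuousRep.homRepMap (mu (v.adicCompletion K) (p ^ J)) i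
  let θ := wF ≫ eD ≫ iD
  -- unfolding `θ`: `(θ m') c = muTransfer (e(c, m'))`
  have hθ_apply : ∀ (m' : W.geomTorsion ((p ^ J : ℕ) : ℤ)) (c : C),
      θ.hom m' c = muTransfer K (v.adicCompletion K) (p ^ J)
        (weilPairingHom W (p ^ J) e hμ hadd₁ hadd₂ (c : W.geomTorsion ((p ^ J : ℕ) : ℤ)) m') := fun _ _ ↦ rfl
  -- classes from the line die under `twistedTorsionToLocalH1` (XXVII/XXVIII), both twists
  have hBu : ∀ c : continuousCohomology 1 (((W.twistedTorsionGaloisModule p κ J u hu).restrict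
      (absGaloisRestrict K (v.adicCompletion K))).subrepresentation C hCu).toTopRep,
      W.twistedTorsionToLocalH1 p κ J u hu (v.adicCompletion K) (cohomologyMap i 1 c) = 0 := fun c ↦ by
    obtain ⟨ξ, rfl⟩ := oneCocycleClass_surjective _ c
    rw [cohomologyMap_oneCocycleClass]
    exact twistedTorsionToLocalH1_oneCocycleClass_eq_zero_of_mem_line W p κ J u hu N C hC hKum _
      (fun σ ↦ (ξ.1 σ).2)
  have hBu' : ∀ c : continuousCohomology 1 (((W.twistedTorsionGaloisModule p κ J u' hu').restrict
      (absGaloisRestrict K (v.adicCompletion K))).subrepresentation C hCu').toTopRep,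
      W.twistedTorsionToLocalH1 p κ J u' hu' (v.adicCompletion K) (cohomologyMap i' 1 c) = 0 := fun c ↦ by
    obtain ⟨ξ, rfl⟩ := oneCocycleClass_surjective _ c
    rw [cohomologyMap_oneCocycleClass]
    exact twistedTorsionToLocalH1_oneCocycleClass_eq_zero_of_mem_line W p κ J u' hu' N C hC hKum _
      (fun σ ↦ (ξ.1 σ).2)
  -- (3) `0 → C(χ_{u'}) → M_{u'} → Hom(C(χ_u), μ) → 0` is short exact
  have hn : ∀ m : W.geomTorsion ((p ^ J : ℕ) : ℤ), (p ^ J) • m = 0 := fun m ↦ AddSubgroup.torsionBy.nsmul m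
  have hnC : ∀ c : C, (p ^ J) • c = 0 := fun c ↦
    Subtype.ext (by rw [AddSubmonoidClass.coe_nsmul, ZeroMemClass.coe_zero]; exact hn _)
  have hSES : IsSES i' θ := by
    refine ⟨?_, fun a b h ↦ Subtype.ext h, fun m' hm' ↦ ?_, ?_⟩
    · -- `θ ∘ i' = 0`: isotropy of `C`
      ext c' c
      change θ.hom (c' : W.geomTorsion ((p ^ J : ℕ) : ℤ)) c = 0
      rw [hθ_apply, weilPairingHom_eq_zero_of_mem_line W p J N.plus hdiv hcard C hC e hμ hadd₁ hadd₂ halt c.2 c'.2,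
        map_zero]
    · -- `ker θ = C`: maximal isotropy of `C`
      refine ⟨⟨m', mem_line_of_forall_weilPairingHom_eq_zero W p J N.plus hdiv hcard C hC e hμ hadd₁ hadd₂ halt
        hnondeg m' fun S hS ↦ ?_⟩, rfl⟩
      have h := congrArg (fun f : HomCarrier C (MuCarrier (v.adicCompletion K) (p ^ J)) ↦ f ⟨S, hS⟩) hm'
      simp only [hθ_apply] at h
      exact muTransfer_injective K (v.adicCompletion K) (p ^ J) (h.trans (map_zero _).symm)
    · -- `θ` surjective: `w`, `e_D` bijective; restriction of characters surjective
      have h1 : Surjective wF.hom :=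
        (W.twistedWeilDual_bijective p κ J hu hu' huu' e hμ hadd₁ hadd₂ hgal hnondeg).2
      have h2 : Surjective eD.hom := (tateDualTransferEquiv v (p ^ J)
        (M := W.geomTorsion ((p ^ J : ℕ) : ℤ))).surjective
      have h3 : Surjective iD.hom :=
        (ContinuousRep.isSES_homRepMap_mkQ_subtype
          ((W.twistedTorsionGaloisModule p κ J u hu).restrict (absGaloisRestrict K (v.adicCompletion K)))
          (mu (v.adicCompletion K) (p ^ J)) C hCu
          (muEquivZMod (v.adicCompletion K) (p ^ J)) hn).surjective
      exact h3.comp (h2.comp h1)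
  -- (1)+(2) `H¹(θ) y' = 0`
  have hθ : cohomologyMap θ 1 y' = 0 := by
    obtain ⟨ι, -, -, hbf⟩ := localDuality_bijective (v.adicCompletion K)
      (((W.twistedTorsionGaloisModule p κ J u hu).restrict
        (absGaloisRestrict K (v.adicCompletion K))).subrepresentation C hCu) hnC
    refine hbf.1 (a₂ := 0) ?_
    rw [map_zero]
    refine AddMonoidHom.ext fun c ↦ ?_
    rw [AddMonoidHom.flip_apply, AddMonoidHom.zero_apply, cohomologyMap_comp_apply, cohomologyMap_comp_apply,
      ContinuousRep.dualityPairing_apply,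
      ← ContPairing.cupProduct_adjoint
        ((((W.twistedTorsionGaloisModule p κ J u hu).restrict
          (absGaloisRestrict K (v.adicCompletion K))).subrepresentation C hCu).evalPairing
            (mu (v.adicCompletion K) (p ^ J)))
        (((W.twistedTorsionGaloisModule p κ J u hu).restrict
          (absGaloisRestrict K (v.adicCompletion K))).evalPairing (mu (v.adicCompletion K) (p ^ J))) i iD
        (fun x f ↦ ContinuousRep.evalPairing_homRepMap (mu (v.adicCompletion K) (p ^ J)) i x f),
      ← ContinuousRep.dualityPairing_apply,
      ← iota_cupProduct_localPairingF v (W.twistedTorsionGaloisModule p κ J u hu) (p ^ J) ι]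
    -- the hypothesis, transported: `⟨H¹(i) c, H¹(w) y'⟩ = 0`
    have h0 : (localPairingF v (W.twistedTorsionGaloisModule p κ J u hu) (p ^ J)).cupProduct
        (cohomologyMap i 1 c) (cohomologyMap wF 1 y') = 0 := by
      have h := H (cohomologyMap i 1 c) (hBu c)
      rw [DiscreteGaloisModule.localTatePairingZMod_apply] at h
      exact (injective_iff_map_eq_zero ιv).1 hι _ h
    rw [h0, map_zero, map_zero]
  -- (3) `y'` comes from `H¹(K_v, C(χ_{u'}))`; (4) those classes die
  obtain ⟨c', hc'⟩ := hSES.exists_map_one_eq_of_map_one_eq_zero y' hθ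
  rw [← hc']
  exact hBu' c'

end NumberField

end Summit.BirchSwinnertonDyer.BirchSwinnertonDyer.Theorems.MultTransportTwistedDescent

end
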